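import Literature.Topology.PlanarFoliations.PatternMinimiser
import Literature.Topology.PlanarFoliations.ChainLimit
import HarnessLib

/-!
# The chain case of the minimiser scheme: a compact frontier leaf of the limit is essential

Topic: Topology / PlanarFoliations, sequel to `PatternMinimiser.lean` (essential patterns, minimal
count, chains of compact minimisers) and `ChainLimit.lean` (the limit set `Dlim` of a strictly
decreasing sequence of compact leaves and its frontier leaves). Two steps of case (M3) of the
scheme (no polygon attains the minimal count):

* `not_imageNull_of_mem_frontier_Dlim` (**proved**): for a strictly decreasing sequence of
  **essential** compact leaves, **a compact leaf through a frontier point of the limit set is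
  essential** — the set of points with image-null leaf is open (`isOpen_setOf_imageNull`) and
  would capture the leaves `K n`, whose points accumulate at the frontier point.
* `discLeaf_subset_Dlim_of_mem_frontier` (**proved**): its disc lies in the limit set (weak
  nesting in every disc of the sequence), hence in every disc of the sequence.

Consequently (`false_of_compact_frontier_leaf_of_cofinal`, **proved**): if the sequence is
cofinal in a family of compact patterns of minimal count inside a minimiser with **no
⊆-least disc**, a compact frontier leaf of the limit is impossible — it would be a least element.

## References

* C. Camacho, A. Lins Neto, *Geometric Theory of Foliations*, Birkhäuser (1985), Ch. VII §2
  [CamachoLinsNeto1985].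
-/

noncomputable section

open Set Filter Function
open _root_.Topology
open Literature.Topology.FourManifolds Literature.Topology.FourManifolds.Foliation Literature.Topology.PlaneTopology

namespace Literature.Topology.PlanarFoliations

variable {X : Type*} [TopologicalSpace X] [T2Space X] [SecondCountableTopology X] [Nonempty X] {F : Foliation ℝ X} {ι : X → ℂ}
variable {B : Type*} [NormedAddCommGroup B] [NormedSpace ℝ B] [LocallyConnectedSpace B] {M : Type*} [TopologicalSpace M]
  {T : Foliation B M} {g : ℂ → M}

namespace StarData

variable (D : StarData F ι T g) (hbi : IsBiOriented F) (hι : IsOpenEmbedding ι) (ho : F.IsTransverselyOriented)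
  {K : ℕ → X} (hK : ∀ n, IsCompact (F.leaf (K n))) (hdec : ∀ n, discLeaf F ι (K (n + 1)) ⊂ discLeaf F ι (K n))

include hbi hι ho hK hdec in
omit [Nonempty X] in
/-- **A leaf through a frontier point of the limit of essential compact leaves is not
image-null.** [folklore] -/
theorem not_imageNull_of_mem_frontier_Dlim (hess : ∀ n, ¬ ImageNull D.foliated (K n)) {y : X}
    (hy : ι y ∈ frontier (Dlim ι F K)) : ¬ ImageNull D.foliated y := by
  intro hnull
  have hopen : IsOpen {w : X | ImageNull D.foliated w} := isOpen_setOf_imageNull hbi D.foliated ho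
  -- the image of this open set is a neighbourhood of `ι y` in the plane
  have hnhds : ι '' {w : X | ImageNull D.foliated w} ∈ 𝓝 (ι y) := (hι.isOpenMap _ hopen).mem_nhds (mem_image_of_mem ι hnull)
  -- it contains points of the curves `K n`
  have hcl := frontier_Dlim_subset_closure hbi hι hK hdec 0 hy
  obtain ⟨z, hz, hzK⟩ := mem_closure_iff_nhds.1 hcl _ hnhds
  obtain ⟨w, hw, rfl⟩ := hz
  obtain ⟨n, -, v, hv, hvw⟩ := mem_iUnion₂.1 hzK
  have : v = w := hι.injective hvw
  subst this
  exact hess n ((ImageNull.of_mem_leaf hw (mem_leaf_comm.1 hv) : ImageNull D.foliated (K n)))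

include hbi hι hK hdec in
omit [Nonempty X] [NormedSpace ℝ B] [LocallyConnectedSpace B] in
/-- **The disc of a compact leaf through a frontier point of the limit lies in the limit set.**
[folklore] -/
theorem discLeaf_subset_Dlim_of_mem_frontier {y : X} (hy : ι y ∈ frontier (Dlim ι F K)) (hcy : IsCompact (F.leaf y)) :
    discLeaf F ι y ⊆ Dlim ι F K := by
  have hyD : ι y ∈ Dlim ι F K := (isCompact_Dlim hbi hι hK).isClosed.frontier_subset hy
  have himg : ι '' F.leaf y ⊆ Dlim ι F K := image_leaf_subset_Dlim hbi hι hK hdec hyD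
  refine subset_iInter fun n ↦ ?_
  exact discLeaf_subset_fill_of_image_subset_fill hbi hι hcy (A := Classical.choose (exists_isJordanLoop_leaf hbi hι (hK n)))
    (Classical.choose_spec (exists_isJordanLoop_leaf hbi hι (hK n))).1
    (by rw [(Classical.choose_spec (exists_isJordanLoop_leaf hbi hι (hK n))).2.2.2]; exact himg.trans (iInter_subset _ n)) |>.trans
    (by rw [(Classical.choose_spec (exists_isJordanLoop_leaf hbi hι (hK n))).2.2.2])

/-! ## No compact frontier leaf for a cofinal sequence in a chain without least element -/

variable {D hbi hι}
variable {x₀ : X} {hC₀ : IsCompact (discLeaf F ι x₀)}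

include ho hK hdec in
/-- **Chain case, compact frontier leaf**: let the strictly decreasing essential compact leaves
`K n` have minimal count and discs in the ambient disc, and be cofinal among the compact patterns
of minimal count with disc in `A` (a set of minimal count containing the discs), a family with no
⊆-least disc. Then no leaf through a frontier point of the limit set is compact. [folklore] -/
theorem false_of_compact_frontier_leaf_of_cofinal (hess : ∀ n, ¬ ImageNull D.foliated (K n))
    (hsub₀ : ∀ n, discLeaf F ι (K n) ⊆ discLeaf F ι x₀) {A : Set ℂ} (hA : D.count A = minCount D hbi hι x₀ hC₀)
    (hKA : ∀ n, discLeaf F ι (K n) ⊆ A)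
    (hcof : ∀ Q : D.CompactPattern x₀, Q.val = minCount D hbi hι x₀ hC₀ → discLeaf F ι Q.y ⊆ A → ∃ n, discLeaf F ι (K n) ⊆ discLeaf F ι Q.y)
    (hnomin : ∀ Q : D.CompactPattern x₀, Q.val = minCount D hbi hι x₀ hC₀ → discLeaf F ι Q.y ⊆ A →
      ∃ Q' : D.CompactPattern x₀, Q'.val = minCount D hbi hι x₀ hC₀ ∧ discLeaf F ι Q'.y ⊆ A ∧ discLeaf F ι Q'.y ⊂ discLeaf F ι Q.y)
    {y : X} (hy : ι y ∈ frontier (Dlim ι F K)) (hcy : IsCompact (F.leaf y)) : False := by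
  -- the compact frontier leaf is an essential compact pattern of minimal count inside `A`
  have hessy := D.not_imageNull_of_mem_frontier_Dlim hbi hι ho hK hdec hess hy
  have hdisc := discLeaf_subset_Dlim_of_mem_frontier hbi hι hK hdec hy hcy
  set L : D.CompactPattern x₀ := ⟨y, hcy, hdisc.trans ((iInter_subset _ 0).trans (hsub₀ 0)), hessy⟩ with hL
  have hLA : discLeaf F ι L.y ⊆ A := hdisc.trans ((iInter_subset _ 0).trans (hKA 0))
  have hLval : L.val = minCount D hbi hι x₀ hC₀ := L.val_eq_of_sub hA hLA
  -- a strictly smaller member, and a `K n` inside it: but `L` is inside every `K n`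
  obtain ⟨Q', hQ'val, hQ'A, hlt⟩ := hnomin L hLval hLA
  obtain ⟨n, hn⟩ := hcof Q' hQ'val hQ'A
  have hLn : discLeaf F ι L.y ⊆ discLeaf F ι (K n) := hdisc.trans (iInter_subset _ n)
  exact hlt.2 (hn.trans' hLn |> fun h ↦ h)

end StarData

end Literature.Topology.PlanarFoliations
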